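import Summits.CriticalPhenomena.SAWScalingLimit.Theorems.SAWMassiveIsingTiltLatticeUniversalityConvergentUpgrade
import Summits.CriticalPhenomena.SAWScalingLimit.Theorems.SAWMassiveIsingTiltLatticeUniversalityFaceLawHonest
import HarnessLib

/-!
# Crux `LatticeUniversality` (stmt-CriticalPhenomena-0807), line `registered` (birth v4) — the relay WITHOUT the
# tightness crux: `K2∀ → YBLimitExists → AngleUniversality → YBtoUniform → LatticeUniversality`, (A)-free

Line lead c4 (prover-line-stmt-CriticalPhenomena-0807-c4-0, 2026-08-17), `--supports stmt-CriticalPhenomena-0807`.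

The registered skeleton v3.4 (`Cruxes/LatticeUniversality/Lines/birth.lean`) closes the crux from FOUR open statements
(`latticeUniversality_of_allFormRelay`, p150118):

  `HexTight` (= stmt-5423) → K2∀ (`stub_hexMicroRobustAll`) → `ThirdToSquareRobustBL` (⇐ stmt-16995 ∧ stmt-16963,
  p144803) → `YBtoUniform` (= stmt-16966) → `LatticeUniversality`,

the tightness crux `HexTight` being used at ONE place: to upgrade the relay's bounded-Lipschitz merging to merging on
all bounded continuous test functions (one-sided Prokhorov, `stub_mergingUpgrade`, p144690). Lead c3 removed it UNDER
(A) (`latticeUniversality_of_hexConjecture_of_allForm`, p153935: the hexagonal side then converges, and bounded-Lipschitz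
merging against a CONVERGENT family is merging on `C_b`, `tendsto_integral_sub_of_tendstoLaw`).

This file removes it (A)-FREE. The transport stub is paid, on this line, through route SAWTrackTransport's items
`YBLimitExists` (stmt-16995: a ROBUST FULL LIMIT `P` of the critical square-tiling Glazman–Manolescu walk, `RL(π/2) P`)
and `AngleUniversality` (stmt-16963: `RL(π/2) P → RL(π/3) P`). These make the YANG–BAXTER side of the relay convergent:
`RL(π/3)` sends the `π/3` laws of the moving domains `S_δ(D) = σD − iδ/2` to `P (σD)`, `RL(π/2)` (at `u ≡ 0`,
`tendstoLaw_of_robustLimit`, p138469) sends the square-tiling laws of `σD` to `P (σD)`. So the convergent upgrade runs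
against the Yang–Baxter side and no tightness of either SAW model is needed:

* `tendstoLaw_hexLaw_of_allForm_robustThird` — **K2∀ → RL(π/3) P → (HexVL)**: for every hexagonal endpoint approximation
  of `D`, the critical hexagonal law of `D` (vertex convention, `hexSAWLaw`), pushed along the quarter turn `σ`, converges
  in law to `P (σD)`. (K2∀ + the exact `π/3` dictionary + the free `iδ/2` displacement give bounded-Lipschitz merging of
  `σ_* P^{Hex}_δ(D)` with the convergent `π/3` laws — `hexThirdShiftBL_of_microRobust`, p144803 —, and
  `tendsto_integral_sub_of_tendstoLaw` upgrades it.)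
* `latticeUniversality_of_allForm_trackTransport` — **K2∀ → YBLimitExists → AngleUniversality → YBtoUniform →
  LatticeUniversality**: exact quarter turn at the `δℤ²` end (`integral_quarterTurn`, p143793), the toll in `σD`
  (16966), `RL(π/2)` and (HexVL); three convergent brackets, subtract. NO `HexTight`, NO (A).
* `latticeUniversality_of_allFormTrackTransport` — the same in arrow form (registered sub-goal of the item).

Consequence (v4 of the line): 0807 ⇐ {K2∀, 16995, 16963, 16966} — the tightness crux stmt-5423 leaves the cost of lattice
universality on this line (it stays available: v3.4's tightness-factored composition p150118 is untouched, for a future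
limit-free proof of the transport in difference form).
-/

noncomputable section

namespace Summit.CriticalPhenomena.SAWScalingLimit.Cruxes.LatticeUniversality.Birth

open MeasureTheory Filter Topology Set
open scoped NNReal ENNReal BoundedContinuousFunction
open Complex (I I_ne_zero)
open Literature.Probability.RandomPlanarGeometry
open Literature.Probability.RandomPlanarGeometry.SAW
open Literature.Probability.RandomPlanarGeometry.SAW.YangBaxter
open Literature.Probability.LatticeModels (Site HexVertex hexGraph hexCenter)
open Summit.CriticalPhenomena.SAWScalingLimit.Theses
open Summit.CriticalPhenomena.SAWScalingLimit.Cruxes.HexTransfer.YbRelay (third IsBdryEdge bdryVertex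
  faceDomain gmSimilarity)
open Summit.CriticalPhenomena.SAWScalingLimit.Theorems.ObservableToSLE.Negative
  (eventually_isProbabilityMeasure_hexSAWLaw)

/-! ### (HexVL): under the kernel, the robust `π/3` limit is the limit of the vertex-convention hexagonal laws -/

/-- **K2∀ → RL(π/3) P → (HexVL).** Let `P` be a chordal family that is the robust full limit at `Θ ≡ π/3` of the
critical Glazman–Manolescu walk (the hypothesis `RL(π/3) P` of route SAWTrackTransport, unfolded: moving domains
`D + u δ`, `‖u δ‖ ≤ δ`, arbitrary admissible mid-edge endpoints). If the kernel K2∀ holds, then for every Dobrushin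
domain `D` and every hexagonal endpoint approximation `(a, b)` of `D`, the critical hexagonal chordal law of `D` between
`a δ, b δ` (vertex convention), pushed along the quarter turn `σ z = i z`, converges in law to `P (σD)`.
Proof: by `hexThirdShiftBL_of_microRobust` (K2∀ + the exact `π/3` dictionary) and the free `iδ/2` displacement,
`σ_* P^{Hex}_δ(D; a, b)` merges on bounded `1`-Lipschitz functions with the `π/3` laws of the moving domains
`S_δ(D) = σD − iδ/2` between boundary mid-edges, which converge to `P (σD)` by `RL(π/3)`; the convergent upgrade
`tendsto_integral_sub_of_tendstoLaw` finishes. [folklore] -/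
theorem tendstoLaw_hexLaw_of_allForm_robustThird
    (hK : (∀ (D : DobrushinDomain) (a b : ℝ → HexVertex), SAW.IsEmbEndpointApprox hexGraph hexCenter D a b → ∀ a' b' : ℝ → MidEdge, (∀ᶠ δ in 𝓝[>] (0 : ℝ), a' δ ≠ b' δ ∧ IsBdryEdge (meshFaces third (((D.map (similarity I I_ne_zero 0)).map (similarity 1 one_ne_zero (-(I * (δ : ℂ) / 2)))).carrier) δ) (a' δ) ∧ IsBdryEdge (meshFaces third (((D.map (similarity I I_ne_zero 0)).map (similarity 1 one_ne_zero (-(I * (δ : ℂ) / 2)))).carrier) δ) (b' δ) ∧ Nonempty (YangBaxterSAW third (((D.map (similarity I I_ne_zero 0)).map (similarity 1 one_ne_zero (-(I * (δ : ℂ) / 2)))).carrier) δ (a' δ) (b' δ))) → Tendsto (fun δ : ℝ => (δ : ℂ) * planeMidpoint third (a' δ)) (𝓝[>] (0 : ℝ)) (𝓝 ((D.map (similarity I I_ne_zero 0)).pt 0)) → Tendsto (fun δ : ℝ => (δ : ℂ) * planeMidpoint third (b' δ)) (𝓝[>] (0 : ℝ)) (𝓝 ((D.map (similarity I I_ne_zero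 0)).pt 1)) → ∀ f : BoundedContinuousFunction (CurveClass ℂ) ℝ, LipschitzWith 1 f → Tendsto (fun δ : ℝ => (∫ γ, f γ.curve ∂(SAW.hexSAWLaw (faceDomain (((D.map (similarity I I_ne_zero 0)).map (similarity 1 one_ne_zero (-(I * (δ : ℂ) / 2)))).carrier) δ (a' δ)) δ (bdryVertex (meshFaces third (((D.map (similarity I I_ne_zero 0)).map (similarity 1 one_ne_zero (-(I * (δ : ℂ) / 2)))).carrier) δ) (a' δ)) (bdryVertex (meshFaces third (((D.map (similarity I I_ne_zero 0)).map (similarity 1 one_ne_zero (-(I * (δ : ℂ) / 2)))).carrier) δ) (b' δ)))) - ∫ γ, f γ.curve ∂(SAW.hexSAWLaw D.carrier δ (a δ) (b δ))) (𝓝[>] (0 : ℝ)) (𝓝 0)))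
    (P : ChordalFamily) (hPch : P.IsChordal)
    (hRL3 : ∀ (D : DobrushinDomain) (u : ℝ → ℂ) (a b : ℝ → MidEdge),
      (∀ᶠ δ in 𝓝[>] (0 : ℝ), ‖u δ‖ ≤ δ) →
      (∀ᶠ δ in 𝓝[>] (0 : ℝ), Nonempty (YangBaxterSAW (fun (_ : ℤ) => Real.pi / 3)
        ((D.map (similarity 1 one_ne_zero (u δ))).carrier) δ (a δ) (b δ))) →
      Tendsto (fun δ : ℝ => (δ : ℂ) * planeMidpoint (fun (_ : ℤ) => Real.pi / 3) (a δ)) (𝓝[>] (0 : ℝ))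
        (𝓝 (D.pt 0)) →
      Tendsto (fun δ : ℝ => (δ : ℂ) * planeMidpoint (fun (_ : ℤ) => Real.pi / 3) (b δ)) (𝓝[>] (0 : ℝ))
        (𝓝 (D.pt 1)) →
      TendstoLaw (fun δ (γ : YangBaxterSAW (fun (_ : ℤ) => Real.pi / 3)
          ((D.map (similarity 1 one_ne_zero (u δ))).carrier) δ (a δ) (b δ)) =>
          γ.curve (fun (_ : ℤ) => Real.pi / 3) δ)
        (fun δ => ybLaw (fun (_ : ℤ) => Real.pi / 3) ((D.map (similarity 1 one_ne_zero (u δ))).carrier) δ 1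
          (a δ) (b δ)) id (P D))
    (D : DobrushinDomain) (a b : ℝ → HexVertex) (hab : SAW.IsEmbEndpointApprox hexGraph hexCenter D a b) :
    TendstoLaw (fun δ (γ : SAW.HexDomainSAW D.carrier δ (a δ) (b δ)) =>
        CurveClass.map (similarity I I_ne_zero 0 : C(ℂ, ℂ)) γ.curve)
      (fun δ => SAW.hexSAWLaw D.carrier δ (a δ) (b δ)) id (P (D.map (similarity I I_ne_zero 0))) := by
  intro g
  haveI : IsProbabilityMeasure (P (D.map (similarity I I_ne_zero 0))) := (hPch _).1
  -- the boundary mid-edge approximation of the moving domains `S_δ(D)` produced by the kernel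
  obtain ⟨a₃, b₃, hne₃, ha₃, hb₃, hH⟩ :=
    hexThirdShiftBL_of_microRobust (hexMicroRobust_of_allForm hK) D a b hab
  -- the `π/3` laws of `S_δ(D)` between them converge to `P (σD)` (robustness at `u δ = −iδ/2`)
  have hconv3 := hRL3 (D.map (similarity I I_ne_zero 0)) (fun δ : ℝ => -(I * (δ : ℂ) / 2)) a₃ b₃
    eventually_norm_halfShift_le hne₃ ha₃ hb₃
  -- bounded-Lipschitz merging of `σ_* P^{Hex}_δ(D)` with those laws
  have hBL : ∀ φ : BoundedContinuousFunction (CurveClass ℂ) ℝ, LipschitzWith 1 φ →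
      Tendsto (fun δ : ℝ =>
          (∫ γ, φ (CurveClass.map (similarity I I_ne_zero 0 : C(ℂ, ℂ)) γ.curve)
              ∂(SAW.hexSAWLaw D.carrier δ (a δ) (b δ))) -
            ∫ γ, φ (γ.curve (fun (_ : ℤ) => Real.pi / 3) δ)
              ∂(ybLaw (fun (_ : ℤ) => Real.pi / 3)
                  (((D.map (similarity I I_ne_zero 0)).map
                    (similarity 1 one_ne_zero ((fun δ : ℝ => -(I * (δ : ℂ) / 2)) δ))).carrier) δ 1
                  (a₃ δ) (b₃ δ)))
        (𝓝[>] (0 : ℝ)) (𝓝 0) := by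
    intro φ hφ
    -- the displacement bracket `S_δ ↔ σ`, squeezed by `δ/2`
    have hS : Tendsto (fun δ : ℝ =>
        (∫ γ, φ (CurveClass.map (gmSimilarity δ : C(ℂ, ℂ)) γ.curve)
            ∂(SAW.hexSAWLaw D.carrier δ (a δ) (b δ))) -
          ∫ γ, φ (CurveClass.map (similarity I I_ne_zero 0 : C(ℂ, ℂ)) γ.curve)
            ∂(SAW.hexSAWLaw D.carrier δ (a δ) (b δ)))
        (𝓝[>] (0 : ℝ)) (𝓝 0) := by
      have h0 : Tendsto (fun δ : ℝ => δ / 2) (𝓝[>] (0 : ℝ)) (𝓝 0) := by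
        have h : Tendsto (fun δ : ℝ => δ / 2) (𝓝 (0 : ℝ)) (𝓝 (0 / 2)) := tendsto_id.div_const 2
        rw [zero_div] at h
        exact tendsto_nhdsWithin_of_tendsto_nhds h
      refine squeeze_zero_norm' ?_ h0
      filter_upwards [self_mem_nhdsWithin] with δ hδ
      exact le_of_eq_of_le (Real.norm_eq_abs _) (abs_integral_shift_sub_le (le_of_lt hδ) φ hφ)
    have h := (hH φ hφ).add hS
    rw [add_zero] at h
    have h' := h.neg
    rw [neg_zero] at h'
    exact h'.congr fun δ => by simp only; ring
  -- the convergent upgrade, then add back the convergence of the `π/3` side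
  have hXY := tendsto_integral_sub_of_tendstoLaw (eventually_isProbabilityMeasure_hexSAWLaw hab)
    (fun δ => SAW.EmbDomainSAW.measurable_of_top _) aemeasurable_id hconv3 hBL g
  have h := hXY.add (hconv3 g)
  rw [zero_add] at h
  exact h.congr fun δ => sub_add_cancel _ _

/-! ### The v4 composition: no tightness, no (A) -/

/-- **`K2∀ → YBLimitExists → AngleUniversality → YBtoUniform → LatticeUniversality`** (crux
stmt-CriticalPhenomena-0807, route `SAWMassiveIsingTilt`'s spelling), (A)-free and WITHOUT the tightness crux `HexTight`.
Fix `D`, `(a, b)`, `(a', b')`, `f`; `σ z = i z`, `g = f ∘ σ⁻¹`. Let `P` be the robust full square-tiling limit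
(`YBLimitExists`); `AngleUniversality` makes it the robust `π/3` limit. Square end: `∫ f dP^{ℤ²}_δ(D; a, b) =
∫ g dP^{ℤ²}_δ(σD; σa, σb)` exactly (`integral_quarterTurn`); the toll (`YBtoUniform`) merges this on `C_b` with the
square-tiling law of `σD` along the landed compass approximation, which converges to `P (σD)` (`RL(π/2)` at `u ≡ 0`,
`tendstoLaw_of_robustLimit`). Hexagonal end: `∫ f dP^{Hex}_δ(D; a', b') = ∫ g d(σ_* P^{Hex}_δ) → ∫ g dP(σD)` by (HexVL)
(`tendstoLaw_hexLaw_of_allForm_robustThird`). Subtract. [folklore] -/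
theorem latticeUniversality_of_allForm_trackTransport
    (hK : (∀ (D : DobrushinDomain) (a b : ℝ → HexVertex), SAW.IsEmbEndpointApprox hexGraph hexCenter D a b → ∀ a' b' : ℝ → MidEdge, (∀ᶠ δ in 𝓝[>] (0 : ℝ), a' δ ≠ b' δ ∧ IsBdryEdge (meshFaces third (((D.map (similarity I I_ne_zero 0)).map (similarity 1 one_ne_zero (-(I * (δ : ℂ) / 2)))).carrier) δ) (a' δ) ∧ IsBdryEdge (meshFaces third (((D.map (similarity I I_ne_zero 0)).map (similarity 1 one_ne_zero (-(I * (δ : ℂ) / 2)))).carrier) δ) (b' δ) ∧ Nonempty (YangBaxterSAW third (((D.map (similarity I I_ne_zero 0)).map (similarity 1 one_ne_zero (-(I * (δ : ℂ) / 2)))).carrier) δ (a' δ) (b' δ))) → Tendsto (fun δ : ℝ => (δ : ℂ) * planeMidpoint third (a' δ)) (𝓝[>] (0 : ℝ)) (𝓝 ((D.map (similarity I I_ne_zero 0)).pt 0)) → Tendsto (fun δ : ℝ => (δ : ℂ) * planeMidpoint third (b' δ)) (𝓝[>] (0 : ℝ)) (𝓝 ((D.map (similarity I I_ne_zero 0)).pt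 1)) → ∀ f : BoundedContinuousFunction (CurveClass ℂ) ℝ, LipschitzWith 1 f → Tendsto (fun δ : ℝ => (∫ γ, f γ.curve ∂(SAW.hexSAWLaw (faceDomain (((D.map (similarity I I_ne_zero 0)).map (similarity 1 one_ne_zero (-(I * (δ : ℂ) / 2)))).carrier) δ (a' δ)) δ (bdryVertex (meshFaces third (((D.map (similarity I I_ne_zero 0)).map (similarity 1 one_ne_zero (-(I * (δ : ℂ) / 2)))).carrier) δ) (a' δ)) (bdryVertex (meshFaces third (((D.map (similarity I I_ne_zero 0)).map (similarity 1 one_ne_zero (-(I * (δ : ℂ) / 2)))).carrier) δ) (b' δ)))) - ∫ γ, f γ.curve ∂(SAW.hexSAWLaw D.carrier δ (a δ) (b δ))) (𝓝[>] (0 : ℝ)) (𝓝 0)))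
    (hL : SAWTrackTransport.YBLimitExists) (hAU : SAWTrackTransport.AngleUniversality)
    (h3 : SAWTrackTransport.YBtoUniform) : SAWMassiveIsingTilt.LatticeUniversality := by
  intro D a b a' b' hab hab' f
  -- the robust full limit `P` of the square-tiling walk, transferred to `π/3`
  obtain ⟨-, P, hPch, hRL2⟩ := hL
  have hmem : Real.pi / 3 ∈ Set.Icc (Real.pi / 3) (2 * Real.pi / 3) := ⟨le_rfl, by linarith [Real.pi_pos]⟩
  have hRL3 := hAU (Real.pi / 3) hmem P hPch hRL2
  -- the rotated `δℤ²` approximation of `σD`; the compass approximation of `σD` on the square tiling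
  have habσ := Cruxes.HexTransfer.PinTheShear.stub_quarterTurnCovariance.2 D a b hab
  obtain ⟨a₂, b₂, hab₂⟩ :=
    Cruxes.HexTransfer.Sketch.stub_compassEndpoints (D.map (similarity I I_ne_zero 0))
  -- the transported test function `g = f ∘ σ⁻¹`, with `g (σ c) = f c`
  set g : BoundedContinuousFunction (CurveClass ℂ) ℝ := f.compContinuous
    ⟨CurveClass.map (similarity (-I) (neg_ne_zero.2 I_ne_zero) 0 : C(ℂ, ℂ)),
      (CurveClass.lipschitzWith_map
        (lipschitzWith_similarity (-I) (neg_ne_zero.2 I_ne_zero) 0)).continuous⟩ with hg_def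
  have hg : ∀ c, g (CurveClass.map (similarity I I_ne_zero 0 : C(ℂ, ℂ)) c) = f c := fun c => by
    simp only [hg_def, BoundedContinuousFunction.compContinuous_apply, ContinuousMap.coe_mk, map_negI_map_I]
  -- bracket 1: the toll in `σD` on `g`
  have hZ := h3 (D.map (similarity I I_ne_zero 0)) (fun δ => ![-(a δ 1), a δ 0])
    (fun δ => ![-(b δ 1), b δ 0]) a₂ b₂ habσ hab₂ g
  -- bracket 2: the square-tiling laws of `σD` converge to `P (σD)` (robust limit at `u ≡ 0`)
  have h2 := Cruxes.HexTransfer.YbRelay.tendstoLaw_of_robustLimit (Real.pi / 2) P hRL2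
    (D.map (similarity I I_ne_zero 0)) a₂ b₂ hab₂ g
  -- bracket 3: the hexagonal laws of `D`, pushed along `σ`, converge to `P (σD)` (HexVL)
  have hX := tendstoLaw_hexLaw_of_allForm_robustThird hK P hPch hRL3 D a' b' hab' g
  -- assemble
  have h := (hZ.add h2).sub hX
  rw [zero_add, sub_self] at h
  refine h.congr fun δ => ?_
  have hq : ∫ γ, g γ.curve ∂(SAW.law (D.map (similarity I I_ne_zero 0)).carrier δ ![-(a δ 1), a δ 0]
      ![-(b δ 1), b δ 0]) = ∫ γ, g (CurveClass.map (similarity I I_ne_zero 0 : C(ℂ, ℂ)) γ.curve)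
        ∂(SAW.law D.carrier δ (a δ) (b δ)) :=
    integral_quarterTurn D.carrier δ (a δ) (b δ) g
  simp only [hg] at hq ⊢
  linarith [hq]

/-! ### Registered sub-goal (arrow form, for `--supports stmt-CriticalPhenomena-0807`) -/

/-- **Registered sub-goal** `latticeUniversality_of_allFormTrackTransport`: K2∀ → YBLimitExists → AngleUniversality →
YBtoUniform → LatticeUniversality (the v4 composition of line `registered`, no tightness, no (A)). [folklore] -/
theorem latticeUniversality_of_allFormTrackTransport : (∀ (D : DobrushinDomain) (a b : ℝ → HexVertex), SAW.IsEmbEndpointApprox hexGraph hexCenter D a b → ∀ a' b' : ℝ → MidEdge, (∀ᶠ δ in 𝓝[>] (0 : ℝ), a' δ ≠ b' δ ∧ IsBdryEdge (meshFaces third (((D.map (similarity I I_ne_zero 0)).map (similarity 1 one_ne_zero (-(I * (δ : ℂ) / 2)))).carrier) δ) (a' δ) ∧ IsBdryEdge (meshFaces third (((D.map (similarity I I_ne_zero 0)).map (similarity 1 one_ne_zero (-(I * (δ : ℂ) / 2)))).carrier) δ) (b' δ) ∧ Nonempty (YangBaxterSAW third (((D.map (similarity I I_ne_zero 0)).map (similarity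 1 one_ne_zero (-(I * (δ : ℂ) / 2)))).carrier) δ (a' δ) (b' δ))) → Tendsto (fun δ : ℝ => (δ : ℂ) * planeMidpoint third (a' δ)) (𝓝[>] (0 : ℝ)) (𝓝 ((D.map (similarity I I_ne_zero 0)).pt 0)) → Tendsto (fun δ : ℝ => (δ : ℂ) * planeMidpoint third (b' δ)) (𝓝[>] (0 : ℝ)) (𝓝 ((D.map (similarity I I_ne_zero 0)).pt 1)) → ∀ f : BoundedContinuousFunction (CurveClass ℂ) ℝ, LipschitzWith 1 f → Tendsto (fun δ : ℝ => (∫ γ, f γ.curve ∂(SAW.hexSAWLaw (faceDomain (((D.map (similarity I I_ne_zero 0)).map (similarity 1 one_ne_zero (-(I * (δ : ℂ) / 2)))).carrier) δ (a' δ)) δ (bdryVertex (meshFaces third (((D.map (similarity I I_ne_zero 0)).map (similarity 1 one_ne_zero (-(I * (δ : ℂ) / 2)))).carrier) δ) (a' δ)) (bdryVertex (meshFaces third (((D.map (similarity I I_ne_zero 0)).map (similarity 1 one_ne_zero (-(I * (δ : ℂ) / 2)))).carrier) δ) (b' δ)))) - ∫ γ, f γ.curve ∂(SAW.hexSAWLaw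 D.carrier δ (a δ) (b δ))) (𝓝[>] (0 : ℝ)) (𝓝 0)) → SAWTrackTransport.YBLimitExists → SAWTrackTransport.AngleUniversality → SAWTrackTransport.YBtoUniform → SAWMassiveIsingTilt.LatticeUniversality :=
  fun hK hL hAU h3 => latticeUniversality_of_allForm_trackTransport hK hL hAU h3

/-! ### Appendix (interface of skeleton v4): the same from the two robust limits alone -/

/-- **Core of the v4 composition: K2∀, a chordal family `P` that is the robust limit of the critical
Glazman–Manolescu walk BOTH on the square tiling (`RL(π/2) P`) and at `Θ ≡ π/3` (`RL(π/3) P`), and the toll give the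
crux.** No `AngleUniversality` as such, no endpoint-existence clause, no tightness, no (A): exact quarter turn at the
`δℤ²` end, toll in `σD` against the landed compass approximation, `RL(π/2)` at `u ≡ 0`, and (HexVL). [folklore] -/
theorem latticeUniversality_of_allForm_robustLimits
    (hK : (∀ (D : DobrushinDomain) (a b : ℝ → HexVertex), SAW.IsEmbEndpointApprox hexGraph hexCenter D a b → ∀ a' b' : ℝ → MidEdge, (∀ᶠ δ in 𝓝[>] (0 : ℝ), a' δ ≠ b' δ ∧ IsBdryEdge (meshFaces third (((D.map (similarity I I_ne_zero 0)).map (similarity 1 one_ne_zero (-(I * (δ : ℂ) / 2)))).carrier) δ) (a' δ) ∧ IsBdryEdge (meshFaces third (((D.map (similarity I I_ne_zero 0)).map (similarity 1 one_ne_zero (-(I * (δ : ℂ) / 2)))).carrier) δ) (b' δ) ∧ Nonempty (YangBaxterSAW third (((D.map (similarity I I_ne_zero 0)).map (similarity 1 one_ne_zero (-(I * (δ : ℂ) / 2)))).carrier) δ (a' δ) (b' δ))) → Tendsto (fun δ : ℝ => (δ : ℂ) * planeMidpoint third (a' δ)) (𝓝[>] (0 : ℝ)) (𝓝 ((D.map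 (similarity I I_ne_zero 0)).pt 0)) → Tendsto (fun δ : ℝ => (δ : ℂ) * planeMidpoint third (b' δ)) (𝓝[>] (0 : ℝ)) (𝓝 ((D.map (similarity I I_ne_zero 0)).pt 1)) → ∀ f : BoundedContinuousFunction (CurveClass ℂ) ℝ, LipschitzWith 1 f → Tendsto (fun δ : ℝ => (∫ γ, f γ.curve ∂(SAW.hexSAWLaw (faceDomain (((D.map (similarity I I_ne_zero 0)).map (similarity 1 one_ne_zero (-(I * (δ : ℂ) / 2)))).carrier) δ (a' δ)) δ (bdryVertex (meshFaces third (((D.map (similarity I I_ne_zero 0)).map (similarity 1 one_ne_zero (-(I * (δ : ℂ) / 2)))).carrier) δ) (a' δ)) (bdryVertex (meshFaces third (((D.map (similarity I I_ne_zero 0)).map (similarity 1 one_ne_zero (-(I * (δ : ℂ) / 2)))).carrier) δ) (b' δ)))) - ∫ γ, f γ.curve ∂(SAW.hexSAWLaw D.carrier δ (a δ) (b δ))) (𝓝[>] (0 : ℝ)) (𝓝 0)))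
    (P : ChordalFamily) (hPch : P.IsChordal)
    (hRL2 : ∀ (D : DobrushinDomain) (u : ℝ → ℂ) (a b : ℝ → MidEdge),
      (∀ᶠ δ in 𝓝[>] (0 : ℝ), ‖u δ‖ ≤ δ) →
      (∀ᶠ δ in 𝓝[>] (0 : ℝ), Nonempty (YangBaxterSAW (fun (_ : ℤ) => Real.pi / 2)
        ((D.map (similarity 1 one_ne_zero (u δ))).carrier) δ (a δ) (b δ))) →
      Tendsto (fun δ : ℝ => (δ : ℂ) * planeMidpoint (fun (_ : ℤ) => Real.pi / 2) (a δ)) (𝓝[>] (0 : ℝ))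
        (𝓝 (D.pt 0)) →
      Tendsto (fun δ : ℝ => (δ : ℂ) * planeMidpoint (fun (_ : ℤ) => Real.pi / 2) (b δ)) (𝓝[>] (0 : ℝ))
        (𝓝 (D.pt 1)) →
      TendstoLaw (fun δ (γ : YangBaxterSAW (fun (_ : ℤ) => Real.pi / 2)
          ((D.map (similarity 1 one_ne_zero (u δ))).carrier) δ (a δ) (b δ)) =>
          γ.curve (fun (_ : ℤ) => Real.pi / 2) δ)
        (fun δ => ybLaw (fun (_ : ℤ) => Real.pi / 2) ((D.map (similarity 1 one_ne_zero (u δ))).carrier) δ 1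
          (a δ) (b δ)) id (P D))
    (hRL3 : ∀ (D : DobrushinDomain) (u : ℝ → ℂ) (a b : ℝ → MidEdge),
      (∀ᶠ δ in 𝓝[>] (0 : ℝ), ‖u δ‖ ≤ δ) →
      (∀ᶠ δ in 𝓝[>] (0 : ℝ), Nonempty (YangBaxterSAW (fun (_ : ℤ) => Real.pi / 3)
        ((D.map (similarity 1 one_ne_zero (u δ))).carrier) δ (a δ) (b δ))) →
      Tendsto (fun δ : ℝ => (δ : ℂ) * planeMidpoint (fun (_ : ℤ) => Real.pi / 3) (a δ)) (𝓝[>] (0 : ℝ))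
        (𝓝 (D.pt 0)) →
      Tendsto (fun δ : ℝ => (δ : ℂ) * planeMidpoint (fun (_ : ℤ) => Real.pi / 3) (b δ)) (𝓝[>] (0 : ℝ))
        (𝓝 (D.pt 1)) →
      TendstoLaw (fun δ (γ : YangBaxterSAW (fun (_ : ℤ) => Real.pi / 3)
          ((D.map (similarity 1 one_ne_zero (u δ))).carrier) δ (a δ) (b δ)) =>
          γ.curve (fun (_ : ℤ) => Real.pi / 3) δ)
        (fun δ => ybLaw (fun (_ : ℤ) => Real.pi / 3) ((D.map (similarity 1 one_ne_zero (u δ))).carrier) δ 1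
          (a δ) (b δ)) id (P D))
    (h3 : SAWTrackTransport.YBtoUniform) : SAWMassiveIsingTilt.LatticeUniversality := by
  intro D a b a' b' hab hab' f
  -- the rotated `δℤ²` approximation of `σD`; the compass approximation of `σD` on the square tiling
  have habσ := Cruxes.HexTransfer.PinTheShear.stub_quarterTurnCovariance.2 D a b hab
  obtain ⟨a₂, b₂, hab₂⟩ :=
    Cruxes.HexTransfer.Sketch.stub_compassEndpoints (D.map (similarity I I_ne_zero 0))
  -- the transported test function `g = f ∘ σ⁻¹`, with `g (σ c) = f c`
  set g : BoundedContinuousFunction (CurveClass ℂ) ℝ := f.compContinuous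
    ⟨CurveClass.map (similarity (-I) (neg_ne_zero.2 I_ne_zero) 0 : C(ℂ, ℂ)),
      (CurveClass.lipschitzWith_map
        (lipschitzWith_similarity (-I) (neg_ne_zero.2 I_ne_zero) 0)).continuous⟩ with hg_def
  have hg : ∀ c, g (CurveClass.map (similarity I I_ne_zero 0 : C(ℂ, ℂ)) c) = f c := fun c => by
    simp only [hg_def, BoundedContinuousFunction.compContinuous_apply, ContinuousMap.coe_mk, map_negI_map_I]
  -- bracket 1: the toll in `σD` on `g`
  have hZ := h3 (D.map (similarity I I_ne_zero 0)) (fun δ => ![-(a δ 1), a δ 0])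
    (fun δ => ![-(b δ 1), b δ 0]) a₂ b₂ habσ hab₂ g
  -- bracket 2: the square-tiling laws of `σD` converge to `P (σD)` (robust limit at `u ≡ 0`)
  have h2 := Cruxes.HexTransfer.YbRelay.tendstoLaw_of_robustLimit (Real.pi / 2) P hRL2
    (D.map (similarity I I_ne_zero 0)) a₂ b₂ hab₂ g
  -- bracket 3: the hexagonal laws of `D`, pushed along `σ`, converge to `P (σD)` (HexVL)
  have hX := tendstoLaw_hexLaw_of_allForm_robustThird hK P hPch hRL3 D a' b' hab' g
  -- assemble
  have h := (hZ.add h2).sub hX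
  rw [zero_add, sub_self] at h
  refine h.congr fun δ => ?_
  have hq : ∫ γ, g γ.curve ∂(SAW.law (D.map (similarity I I_ne_zero 0)).carrier δ ![-(a δ 1), a δ 0]
      ![-(b δ 1), b δ 0]) = ∫ γ, g (CurveClass.map (similarity I I_ne_zero 0 : C(ℂ, ℂ)) γ.curve)
        ∂(SAW.law D.carrier δ (a δ) (b δ)) :=
    integral_quarterTurn D.carrier δ (a δ) (b δ) g
  simp only [hg] at hq ⊢
  linarith [hq]

/-- **K2∀ → (∃ P chordal, RL(π/2) P) → AngleUniversality → YBtoUniform → LatticeUniversality**: the v4 composition with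
the robust square-tiling limit spelled as conjunct (ii) of `YBLimitExists` (stmt-16995) ALONE — the endpoint-existence
conjunct (i) of that item (all angles `α ∈ [π/3, 2π/3]`) is not used by the relay. This is the form fed by the v4
skeleton's stub `stub_ybRobustLimit`. [folklore] -/
theorem latticeUniversality_of_allForm_robustSquare
    (hK : (∀ (D : DobrushinDomain) (a b : ℝ → HexVertex), SAW.IsEmbEndpointApprox hexGraph hexCenter D a b → ∀ a' b' : ℝ → MidEdge, (∀ᶠ δ in 𝓝[>] (0 : ℝ), a' δ ≠ b' δ ∧ IsBdryEdge (meshFaces third (((D.map (similarity I I_ne_zero 0)).map (similarity 1 one_ne_zero (-(I * (δ : ℂ) / 2)))).carrier) δ) (a' δ) ∧ IsBdryEdge (meshFaces third (((D.map (similarity I I_ne_zero 0)).map (similarity 1 one_ne_zero (-(I * (δ : ℂ) / 2)))).carrier) δ) (b' δ) ∧ Nonempty (YangBaxterSAW third (((D.map (similarity I I_ne_zero 0)).map (similarity 1 one_ne_zero (-(I * (δ : ℂ) / 2)))).carrier) δ (a' δ) (b' δ))) → Tendsto (fun δ : ℝ => (δ : ℂ) * planeMidpoint third (a' δ)) (𝓝[>]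 (0 : ℝ)) (𝓝 ((D.map (similarity I I_ne_zero 0)).pt 0)) → Tendsto (fun δ : ℝ => (δ : ℂ) * planeMidpoint third (b' δ)) (𝓝[>] (0 : ℝ)) (𝓝 ((D.map (similarity I I_ne_zero 0)).pt 1)) → ∀ f : BoundedContinuousFunction (CurveClass ℂ) ℝ, LipschitzWith 1 f → Tendsto (fun δ : ℝ => (∫ γ, f γ.curve ∂(SAW.hexSAWLaw (faceDomain (((D.map (similarity I I_ne_zero 0)).map (similarity 1 one_ne_zero (-(I * (δ : ℂ) / 2)))).carrier) δ (a' δ)) δ (bdryVertex (meshFaces third (((D.map (similarity I I_ne_zero 0)).map (similarity 1 one_ne_zero (-(I * (δ : ℂ) / 2)))).carrier) δ) (a' δ)) (bdryVertex (meshFaces third (((D.map (similarity I I_ne_zero 0)).map (similarity 1 one_ne_zero (-(I * (δ : ℂ) / 2)))).carrier) δ) (b' δ)))) - ∫ γ, f γ.curve ∂(SAW.hexSAWLaw D.carrier δ (a δ) (b δ))) (𝓝[>] (0 : ℝ)) (𝓝 0)))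
    (hL : ∃ P : ChordalFamily, P.IsChordal ∧ ∀ (D : DobrushinDomain) (u : ℝ → ℂ) (a b : ℝ → MidEdge), (∀ᶠ δ in 𝓝[>] (0 : ℝ), ‖u δ‖ ≤ δ) → (∀ᶠ δ in 𝓝[>] (0 : ℝ), Nonempty (YangBaxterSAW (fun (_ : ℤ) => Real.pi / 2) ((D.map (similarity 1 one_ne_zero (u δ))).carrier) δ (a δ) (b δ))) → Tendsto (fun δ : ℝ => (δ : ℂ) * planeMidpoint (fun (_ : ℤ) => Real.pi / 2) (a δ)) (𝓝[>] (0 : ℝ)) (𝓝 (D.pt 0)) → Tendsto (fun δ : ℝ => (δ : ℂ) * planeMidpoint (fun (_ : ℤ) => Real.pi / 2) (b δ)) (𝓝[>] (0 : ℝ)) (𝓝 (D.pt 1)) → TendstoLaw (fun δ (γ : YangBaxterSAW (fun (_ : ℤ) => Real.pi / 2) ((D.map (similarity 1 one_ne_zero (u δ))).carrier) δ (a δ) (b δ)) => γ.curve (fun (_ : ℤ) => Real.pi / 2) δ) (fun δ => ybLaw (fun (_ : ℤ) => Real.pi / 2) ((D.map (similarity 1 one_ne_zero (u δ))).carrier)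 δ 1 (a δ) (b δ)) id (P D))
    (hAU : SAWTrackTransport.AngleUniversality) (h3 : SAWTrackTransport.YBtoUniform) :
    SAWMassiveIsingTilt.LatticeUniversality := by
  obtain ⟨P, hPch, hRL2⟩ := hL
  have hmem : Real.pi / 3 ∈ Set.Icc (Real.pi / 3) (2 * Real.pi / 3) := ⟨le_rfl, by linarith [Real.pi_pos]⟩
  exact latticeUniversality_of_allForm_robustLimits hK P hPch hRL2 (hAU (Real.pi / 3) hmem P hPch hRL2) h3

/-- **The line's by-product for the hexagonal model alone**: K2∀, a robust square-tiling limit (conjunct (ii) of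
stmt-16995) and `AngleUniversality` (stmt-16963) give the critical hexagonal SAW in the VERTEX convention — every
Dobrushin domain, every hexagonal endpoint approximation — a full chordal scaling limit, namely `D ↦ P (σD)` seen through
the quarter turn `σ` (unidentified; no (A), no tightness). [folklore] -/
theorem hexLimit_of_allForm_robustSquare
    (hK : (∀ (D : DobrushinDomain) (a b : ℝ → HexVertex), SAW.IsEmbEndpointApprox hexGraph hexCenter D a b → ∀ a' b' : ℝ → MidEdge, (∀ᶠ δ in 𝓝[>] (0 : ℝ), a' δ ≠ b' δ ∧ IsBdryEdge (meshFaces third (((D.map (similarity I I_ne_zero 0)).map (similarity 1 one_ne_zero (-(I * (δ : ℂ) / 2)))).carrier) δ) (a' δ) ∧ IsBdryEdge (meshFaces third (((D.map (similarity I I_ne_zero 0)).map (similarity 1 one_ne_zero (-(I * (δ : ℂ) / 2)))).carrier) δ) (b' δ) ∧ Nonempty (YangBaxterSAW third (((D.map (similarity I I_ne_zero 0)).map (similarity 1 one_ne_zero (-(I * (δ : ℂ) / 2)))).carrier) δ (a' δ) (b' δ))) → Tendsto (fun δ : ℝ => (δ : ℂ) * planeMidpoint third (a' δ)) (𝓝[>]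 (0 : ℝ)) (𝓝 ((D.map (similarity I I_ne_zero 0)).pt 0)) → Tendsto (fun δ : ℝ => (δ : ℂ) * planeMidpoint third (b' δ)) (𝓝[>] (0 : ℝ)) (𝓝 ((D.map (similarity I I_ne_zero 0)).pt 1)) → ∀ f : BoundedContinuousFunction (CurveClass ℂ) ℝ, LipschitzWith 1 f → Tendsto (fun δ : ℝ => (∫ γ, f γ.curve ∂(SAW.hexSAWLaw (faceDomain (((D.map (similarity I I_ne_zero 0)).map (similarity 1 one_ne_zero (-(I * (δ : ℂ) / 2)))).carrier) δ (a' δ)) δ (bdryVertex (meshFaces third (((D.map (similarity I I_ne_zero 0)).map (similarity 1 one_ne_zero (-(I * (δ : ℂ) / 2)))).carrier) δ) (a' δ)) (bdryVertex (meshFaces third (((D.map (similarity I I_ne_zero 0)).map (similarity 1 one_ne_zero (-(I * (δ : ℂ) / 2)))).carrier) δ) (b' δ)))) - ∫ γ, f γ.curve ∂(SAW.hexSAWLaw D.carrier δ (a δ) (b δ))) (𝓝[>] (0 : ℝ)) (𝓝 0)))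
    (hL : ∃ P : ChordalFamily, P.IsChordal ∧ ∀ (D : DobrushinDomain) (u : ℝ → ℂ) (a b : ℝ → MidEdge), (∀ᶠ δ in 𝓝[>] (0 : ℝ), ‖u δ‖ ≤ δ) → (∀ᶠ δ in 𝓝[>] (0 : ℝ), Nonempty (YangBaxterSAW (fun (_ : ℤ) => Real.pi / 2) ((D.map (similarity 1 one_ne_zero (u δ))).carrier) δ (a δ) (b δ))) → Tendsto (fun δ : ℝ => (δ : ℂ) * planeMidpoint (fun (_ : ℤ) => Real.pi / 2) (a δ)) (𝓝[>] (0 : ℝ)) (𝓝 (D.pt 0)) → Tendsto (fun δ : ℝ => (δ : ℂ) * planeMidpoint (fun (_ : ℤ) => Real.pi / 2) (b δ)) (𝓝[>] (0 : ℝ)) (𝓝 (D.pt 1)) → TendstoLaw (fun δ (γ : YangBaxterSAW (fun (_ : ℤ) => Real.pi / 2) ((D.map (similarity 1 one_ne_zero (u δ))).carrier) δ (a δ) (b δ)) => γ.curve (fun (_ : ℤ) => Real.pi / 2) δ) (fun δ => ybLaw (fun (_ : ℤ) => Real.pi / 2) ((D.map (similarity 1 one_ne_zero (u δ))).carrier)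 δ 1 (a δ) (b δ)) id (P D))
    (hAU : SAWTrackTransport.AngleUniversality) :
    ∃ P : ChordalFamily, P.IsChordal ∧ ∀ (D : DobrushinDomain) (a b : ℝ → HexVertex),
      SAW.IsEmbEndpointApprox hexGraph hexCenter D a b →
      TendstoLaw (fun δ (γ : SAW.HexDomainSAW D.carrier δ (a δ) (b δ)) =>
          CurveClass.map (similarity I I_ne_zero 0 : C(ℂ, ℂ)) γ.curve)
        (fun δ => SAW.hexSAWLaw D.carrier δ (a δ) (b δ)) id (P (D.map (similarity I I_ne_zero 0))) := by
  obtain ⟨P, hPch, hRL2⟩ := hL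
  have hmem : Real.pi / 3 ∈ Set.Icc (Real.pi / 3) (2 * Real.pi / 3) := ⟨le_rfl, by linarith [Real.pi_pos]⟩
  exact ⟨P, hPch, tendstoLaw_hexLaw_of_allForm_robustThird hK P hPch (hAU (Real.pi / 3) hmem P hPch hRL2)⟩

/-! ### Registered sub-goal (arrow form): the v4 skeleton's composition -/

/-- **Registered sub-goal** `latticeUniversality_of_allFormRobustSquare`: K2∀ → (conjunct (ii) of `YBLimitExists`) →
AngleUniversality → YBtoUniform → LatticeUniversality — the composition of skeleton v4 of line `registered`, whose four
stubs are exactly these four antecedents. [folklore] -/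
theorem latticeUniversality_of_allFormRobustSquare : (∀ (D : DobrushinDomain) (a b : ℝ → HexVertex), SAW.IsEmbEndpointApprox hexGraph hexCenter D a b → ∀ a' b' : ℝ → MidEdge, (∀ᶠ δ in 𝓝[>] (0 : ℝ), a' δ ≠ b' δ ∧ IsBdryEdge (meshFaces third (((D.map (similarity I I_ne_zero 0)).map (similarity 1 one_ne_zero (-(I * (δ : ℂ) / 2)))).carrier) δ) (a' δ) ∧ IsBdryEdge (meshFaces third (((D.map (similarity I I_ne_zero 0)).map (similarity 1 one_ne_zero (-(I * (δ : ℂ) / 2)))).carrier) δ) (b' δ) ∧ Nonempty (YangBaxterSAW third (((D.map (similarity I I_ne_zero 0)).map (similarity 1 one_ne_zero (-(I * (δ : ℂ) / 2)))).carrier) δ (a' δ) (b' δ))) → Tendsto (fun δ : ℝ => (δ : ℂ) * planeMidpoint third (a' δ)) (𝓝[>] (0 : ℝ)) (𝓝 ((D.map (similarity I I_ne_zero 0)).pt 0)) → Tendsto (fun δ : ℝ => (δ : ℂ) * planeMidpoint third (b' δ)) (𝓝[>] (0 : ℝ)) (𝓝 ((D.map (similarity I I_ne_zero 0)).pt 1))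 → ∀ f : BoundedContinuousFunction (CurveClass ℂ) ℝ, LipschitzWith 1 f → Tendsto (fun δ : ℝ => (∫ γ, f γ.curve ∂(SAW.hexSAWLaw (faceDomain (((D.map (similarity I I_ne_zero 0)).map (similarity 1 one_ne_zero (-(I * (δ : ℂ) / 2)))).carrier) δ (a' δ)) δ (bdryVertex (meshFaces third (((D.map (similarity I I_ne_zero 0)).map (similarity 1 one_ne_zero (-(I * (δ : ℂ) / 2)))).carrier) δ) (a' δ)) (bdryVertex (meshFaces third (((D.map (similarity I I_ne_zero 0)).map (similarity 1 one_ne_zero (-(I * (δ : ℂ) / 2)))).carrier) δ) (b' δ)))) - ∫ γ, f γ.curve ∂(SAW.hexSAWLaw D.carrier δ (a δ) (b δ))) (𝓝[>] (0 : ℝ)) (𝓝 0)) → (∃ P : ChordalFamily, P.IsChordal ∧ ∀ (D : DobrushinDomain) (u : ℝ → ℂ) (a b : ℝ → MidEdge), (∀ᶠ δ in 𝓝[>] (0 : ℝ), ‖u δ‖ ≤ δ) → (∀ᶠ δ in 𝓝[>] (0 : ℝ), Nonempty (YangBaxterSAW (fun (_ : ℤ) => Real.pi / 2) ((D.map (similarity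 1 one_ne_zero (u δ))).carrier) δ (a δ) (b δ))) → Tendsto (fun δ : ℝ => (δ : ℂ) * planeMidpoint (fun (_ : ℤ) => Real.pi / 2) (a δ)) (𝓝[>] (0 : ℝ)) (𝓝 (D.pt 0)) → Tendsto (fun δ : ℝ => (δ : ℂ) * planeMidpoint (fun (_ : ℤ) => Real.pi / 2) (b δ)) (𝓝[>] (0 : ℝ)) (𝓝 (D.pt 1)) → TendstoLaw (fun δ (γ : YangBaxterSAW (fun (_ : ℤ) => Real.pi / 2) ((D.map (similarity 1 one_ne_zero (u δ))).carrier) δ (a δ) (b δ)) => γ.curve (fun (_ : ℤ) => Real.pi / 2) δ) (fun δ => ybLaw (fun (_ : ℤ) => Real.pi / 2) ((D.map (similarity 1 one_ne_zero (u δ))).carrier) δ 1 (a δ) (b δ)) id (P D)) → SAWTrackTransport.AngleUniversality → SAWTrackTransport.YBtoUniform → SAWMassiveIsingTilt.LatticeUniversality :=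
  fun hK hL hAU h3 => latticeUniversality_of_allForm_robustSquare hK hL hAU h3

end Summit.CriticalPhenomena.SAWScalingLimit.Cruxes.LatticeUniversality.Birth

end
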